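import Summits.Ventures.Crystal3D.Theorems.StickyWulffConstantCoaxialWallLawTripleVacancy
import Summits.Ventures.Crystal3D.Theorems.StickyWulffConstantCoaxialWallLawFrame
import HarnessLib

/-!
# Three foreign contacts of a lattice ball with three vacancies: the face-twin pattern (lattice form)

HONEST FRAMING. Part of the venture `Summits/Ventures/Crystal3D` (cell `crystal3d-full`), helper
`--supports` the crux `CoaxialWallLaw` (stmt-Ventures-19481, `route-Ventures-StickyWulffConstant`),
REGISTERED line `WallLedgerF` (planner cf-p1 gen 16), stub `stub_coaxialTwoSlabAdhesion`
(terrace/riser slot ledger, absorption of foreign contacts).  Transports the cubic-frame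
triple-vacancy lemma `cubicShell_triple_vacancy` (`…CoaxialWallLawTripleVacancy`) to the model
lattice and to moved lattices, exactly as `fcc_double_vacancy(_moved)` transported the `k = 2`
atom.

* `fcc_triple_vacancy` — `q ∈ Λ₀` with three distinct nearest-neighbour sites `z₁, z₂, z₃`; if
  three points `y₁, y₂, y₃ ∉ Λ₀` at distance `1` from `q`, pairwise at distance `≥ 1`, keep
  distance `≥ 1` from every nearest-neighbour site of `q` other than `z₁, z₂, z₃`, then
  `z₁, z₂, z₃` are pairwise at distance `1` (a TRIANGULAR FACE of the kissing shell) and each `yᵢ`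
  is one of the three TWIN POSITIONS `(2/3)(z₁ + z₂ + z₃) − zⱼ` over that face;
* `fcc_triple_vacancy_moved` — the same for `A·Λ₀ + t`.

Ledger reading: a lattice ball with three vacant slots and three foreign contacts (saturated,
`deg = 12`) has its vacancies on a triangular face and its foreign partners in twin registry over
it; with L3′ (≤ 3 foreign contacts from a rigid grain) every other lattice ball with an in-plane
vacancy keeps `12 − deg ≥ 1`.
WHAT THIS IS NOT: the exclusion of the face-twin pattern for twin pairs / the axis rule, the
stub; rung F-C1 not moved.
-/

noncomputable section

namespace Summit.Ventures.Crystal3D.Theorems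

open Summit.Ventures.Crystal3D Finset
open Literature.MathematicalPhysics.StatisticalMechanics (barlowPos barlowStacking fccStacking
  constHagg haggLabel_const barlowPos_mem)

/-- **Triple-vacancy lemma (`Λ₀` form).**  See the module docstring. -/
theorem fcc_triple_vacancy (q y₁ y₂ y₃ z₁ z₂ z₃ : EuclideanSpace ℝ (Fin 3))
    (hq : q ∈ fccStacking 1 (Real.sqrt (2 / 3))) (hz₁ : z₁ ∈ fccStacking 1 (Real.sqrt (2 / 3)))
    (hz₂ : z₂ ∈ fccStacking 1 (Real.sqrt (2 / 3))) (hz₃ : z₃ ∈ fccStacking 1 (Real.sqrt (2 / 3)))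
    (hqz₁ : dist q z₁ = 1) (hqz₂ : dist q z₂ = 1) (hqz₃ : dist q z₃ = 1)
    (h12 : z₁ ≠ z₂) (h13 : z₁ ≠ z₃) (h23 : z₂ ≠ z₃)
    (hy₁ : dist q y₁ = 1) (hy₂ : dist q y₂ = 1) (hy₃ : dist q y₃ = 1)
    (hy₁Λ : y₁ ∉ fccStacking 1 (Real.sqrt (2 / 3))) (hy₂Λ : y₂ ∉ fccStacking 1 (Real.sqrt (2 / 3)))
    (hy₃Λ : y₃ ∉ fccStacking 1 (Real.sqrt (2 / 3)))
    (hy₁₂ : 1 ≤ dist y₁ y₂) (hy₁₃ : 1 ≤ dist y₁ y₃) (hy₂₃ : 1 ≤ dist y₂ y₃)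
    (h : ∀ z ∈ fccStacking 1 (Real.sqrt (2 / 3)), dist q z = 1 → z ≠ z₁ → z ≠ z₂ → z ≠ z₃ →
      1 ≤ dist y₁ z ∧ 1 ≤ dist y₂ z ∧ 1 ≤ dist y₃ z) :
    (dist z₁ z₂ = 1 ∧ dist z₁ z₃ = 1 ∧ dist z₂ z₃ = 1) ∧
    (y₁ = (2 / 3 : ℝ) • (z₁ + z₂ + z₃) - z₁ ∨ y₁ = (2 / 3 : ℝ) • (z₁ + z₂ + z₃) - z₂ ∨
      y₁ = (2 / 3 : ℝ) • (z₁ + z₂ + z₃) - z₃) ∧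
    (y₂ = (2 / 3 : ℝ) • (z₁ + z₂ + z₃) - z₁ ∨ y₂ = (2 / 3 : ℝ) • (z₁ + z₂ + z₃) - z₂ ∨
      y₂ = (2 / 3 : ℝ) • (z₁ + z₂ + z₃) - z₃) ∧
    (y₃ = (2 / 3 : ℝ) • (z₁ + z₂ + z₃) - z₁ ∨ y₃ = (2 / 3 : ℝ) • (z₁ + z₂ + z₃) - z₂ ∨
      y₃ = (2 / 3 : ℝ) • (z₁ + z₂ + z₃) - z₃) := by
  obtain ⟨k₀, i₀, j₀, rfl⟩ := hq
  set q := barlowPos 1 (Real.sqrt (2 / 3)) constHagg k₀ i₀ j₀ with hqdef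
  -- cubic coordinates of a point relative to `q`
  let A : EuclideanSpace ℝ (Fin 3) → ℝ := fun p =>
    (p - q) 0 + Real.sqrt 3 / 3 * (p - q) 1 - Real.sqrt (2 / 3) * (p - q) 2
  let B : EuclideanSpace ℝ (Fin 3) → ℝ := fun p =>
    (p - q) 0 - Real.sqrt 3 / 3 * (p - q) 1 + Real.sqrt (2 / 3) * (p - q) 2
  let C : EuclideanSpace ℝ (Fin 3) → ℝ := fun p =>
    2 * Real.sqrt 3 / 3 * (p - q) 1 + Real.sqrt (2 / 3) * (p - q) 2
  have hAp : ∀ p, A p = (p - q) 0 + Real.sqrt 3 / 3 * (p - q) 1 - Real.sqrt (2 / 3) * (p - q) 2 :=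
    fun p => rfl
  have hBp : ∀ p, B p = (p - q) 0 - Real.sqrt 3 / 3 * (p - q) 1 + Real.sqrt (2 / 3) * (p - q) 2 :=
    fun p => rfl
  have hCp : ∀ p, C p = 2 * Real.sqrt 3 / 3 * (p - q) 1 + Real.sqrt (2 / 3) * (p - q) 2 :=
    fun p => rfl
  -- `2·dist(p, p')² = (A p − A p')² + (B p − B p')² + (C p − C p')²`
  have hcub : ∀ p p' : EuclideanSpace ℝ (Fin 3),
      2 * dist p p' ^ 2 = (A p - A p') ^ 2 + (B p - B p') ^ 2 + (C p - C p') ^ 2 := by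
    intro p p'
    have h0 := two_mul_norm_sq_eq_cubic (p - p')
    have e : ∀ l, (p - p') l = (p - q) l - (p' - q) l := fun l => by
      simp only [PiLp.sub_apply]; ring
    rw [e 0, e 1, e 2] at h0
    rw [dist_eq_norm, h0, hAp, hAp, hBp, hBp, hCp, hCp]
    ring
  have hAq : A q = 0 ∧ B q = 0 ∧ C q = 0 := by
    rw [hAp, hBp, hCp]
    simp only [sub_self, PiLp.zero_apply]; norm_num
  have hnorm : ∀ p, dist q p = 1 → A p ^ 2 + B p ^ 2 + C p ^ 2 = 2 := by
    intro p hp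
    have h0 := hcub p q
    rw [dist_comm, hp, hAq.1, hAq.2.1, hAq.2.2] at h0
    linarith only [h0]
  -- mutual inner products `≤ 1`
  have hinner : ∀ p p', dist q p = 1 → dist q p' = 1 → 1 ≤ dist p p' →
      A p * A p' + B p * B p' + C p * C p' ≤ 1 := by
    intro p p' hp hp' hpp'
    have h0 := hcub p p'
    have hd1 : 1 ≤ dist p p' ^ 2 := one_le_pow₀ hpp'
    have hexp : (A p - A p') ^ 2 + (B p - B p') ^ 2 + (C p - C p') ^ 2 =
        (A p ^ 2 + B p ^ 2 + C p ^ 2) + (A p' ^ 2 + B p' ^ 2 + C p' ^ 2) -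
          2 * (A p * A p' + B p * B p' + C p * C p') := by ring
    linarith only [h0, hd1, hnorm p hp, hnorm p' hp', hexp]
  -- equal cubic coordinates ⇒ equal points
  have hident : ∀ (s : ℤ × ℤ × ℤ) (z p : EuclideanSpace ℝ (Fin 3)),
      A z = s.1 ∧ B z = s.2.1 ∧ C z = s.2.2 → A p = s.1 ∧ B p = s.2.1 ∧ C p = s.2.2 →
      p = z := by
    rintro s z p ⟨h1, h2, h3⟩ ⟨e1, e2, e3⟩
    apply eq_of_cubic_sub_eq p z q
    · show A p = A z
      rw [h1, e1]
    · show B p = B z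
      rw [h2, e2]
    · show C p = C z
      rw [h3, e3]
  -- cubic coordinates of `z₁, z₂, z₃`
  obtain ⟨v₁, hv₁, hv₁A, hv₁B, hv₁C⟩ := cubic_of_unit_neighbour z₁ hz₁ k₀ i₀ j₀ hqz₁
  obtain ⟨v₂, hv₂, hv₂A, hv₂B, hv₂C⟩ := cubic_of_unit_neighbour z₂ hz₂ k₀ i₀ j₀ hqz₂
  obtain ⟨v₃, hv₃, hv₃A, hv₃B, hv₃C⟩ := cubic_of_unit_neighbour z₃ hz₃ k₀ i₀ j₀ hqz₃
  have hv₁' : A z₁ = v₁.1 ∧ B z₁ = v₁.2.1 ∧ C z₁ = v₁.2.2 := ⟨hv₁A, hv₁B, hv₁C⟩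
  have hv₂' : A z₂ = v₂.1 ∧ B z₂ = v₂.2.1 ∧ C z₂ = v₂.2.2 := ⟨hv₂A, hv₂B, hv₂C⟩
  have hv₃' : A z₃ = v₃.1 ∧ B z₃ = v₃.2.1 ∧ C z₃ = v₃.2.2 := ⟨hv₃A, hv₃B, hv₃C⟩
  -- distinct sites have distinct slot triples, and conversely
  have hsv : ∀ (s w : ℤ × ℤ × ℤ) (z zw : EuclideanSpace ℝ (Fin 3)),
      A z = s.1 ∧ B z = s.2.1 ∧ C z = s.2.2 → A zw = w.1 ∧ B zw = w.2.1 ∧ C zw = w.2.2 →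
      s ≠ w → z ≠ zw := by
    rintro s w z zw hz hw hsw hzz
    apply hsw
    rw [hzz] at hz
    have e1 : (s.1 : ℝ) = w.1 := by rw [← hz.1, hw.1]
    have e2 : (s.2.1 : ℝ) = w.2.1 := by rw [← hz.2.1, hw.2.1]
    have e3 : (s.2.2 : ℝ) = w.2.2 := by rw [← hz.2.2, hw.2.2]
    have e1' : s.1 = w.1 := by exact_mod_cast e1
    have e2' : s.2.1 = w.2.1 := by exact_mod_cast e2
    have e3' : s.2.2 = w.2.2 := by exact_mod_cast e3
    exact Prod.ext e1' (Prod.ext e2' e3')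
  have hne12 : v₁ ≠ v₂ := fun e => h12 (hident v₂ z₂ z₁ hv₂' (by rw [← e]; exact hv₁'))
  have hne13 : v₁ ≠ v₃ := fun e => h13 (hident v₃ z₃ z₁ hv₃' (by rw [← e]; exact hv₁'))
  have hne23 : v₂ ≠ v₃ := fun e => h23 (hident v₃ z₃ z₂ hv₃' (by rw [← e]; exact hv₂'))
  -- a site at each slot offset
  have hsite : ∀ s ∈ ([((1 : ℤ), (1 : ℤ), (0 : ℤ)), (1, -1, 0), (-1, 1, 0), (-1, -1, 0), (1, 0, 1), (1, 0, -1),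
        (-1, 0, 1), (-1, 0, -1), (0, 1, 1), (0, 1, -1), (0, -1, 1), (0, -1, -1)] : List (ℤ × ℤ × ℤ)), ∃ z ∈ fccStacking 1 (Real.sqrt (2 / 3)), dist q z = 1 ∧
      (A z = s.1 ∧ B z = s.2.1 ∧ C z = s.2.2) := by
    intro s hs
    obtain ⟨hsmod, hsn0⟩ := cubicShell_facts s hs
    have hse : Even (s.1 + s.2.1 + s.2.2) := Int.even_iff.2 hsmod
    have hsn : (s.1 : ℝ) ^ 2 + (s.2.1 : ℝ) ^ 2 + (s.2.2 : ℝ) ^ 2 = 2 := by exact_mod_cast hsn0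
    obtain ⟨z, hzΛ, hzA, hzB, hzC, hzd⟩ := exists_site_at_cubic_offset k₀ i₀ j₀ s hse
    rw [hsn] at hzd
    have hqz : dist q z = 1 := by
      have hsq1 : dist q z ^ 2 = 1 := by linarith
      exact (pow_eq_one_iff_of_nonneg dist_nonneg two_ne_zero).1 hsq1
    exact ⟨z, hzΛ, hqz, hzA, hzB, hzC⟩
  -- the slot constraints for a point touching `q`
  have hslots : ∀ p, dist q p = 1 → (∀ z ∈ fccStacking 1 (Real.sqrt (2 / 3)), dist q z = 1 →
        z ≠ z₁ → z ≠ z₂ → z ≠ z₃ → 1 ≤ dist p z) →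
      ∀ s ∈ ([((1 : ℤ), (1 : ℤ), (0 : ℤ)), (1, -1, 0), (-1, 1, 0), (-1, -1, 0), (1, 0, 1), (1, 0, -1),
        (-1, 0, 1), (-1, 0, -1), (0, 1, 1), (0, 1, -1), (0, -1, 1), (0, -1, -1)] : List (ℤ × ℤ × ℤ)), s ≠ v₁ → s ≠ v₂ → s ≠ v₃ →
        A p * (s.1 : ℝ) + B p * (s.2.1 : ℝ) + C p * (s.2.2 : ℝ) ≤ 1 := by
    intro p hp hpz s hs hs1 hs2 hs3
    obtain ⟨-, hsn0⟩ := cubicShell_facts s hs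
    have hsn : (s.1 : ℝ) ^ 2 + (s.2.1 : ℝ) ^ 2 + (s.2.2 : ℝ) ^ 2 = 2 := by exact_mod_cast hsn0
    obtain ⟨z, hzΛ, hqz, hz'⟩ := hsite s hs
    have hpz1 := hpz z hzΛ hqz (hsv s v₁ z z₁ hz' hv₁' hs1) (hsv s v₂ z z₂ hz' hv₂' hs2)
      (hsv s v₃ z z₃ hz' hv₃' hs3)
    have h0 := hcub p z
    rw [hz'.1, hz'.2.1, hz'.2.2] at h0
    have hd1 : 1 ≤ dist p z ^ 2 := one_le_pow₀ hpz1
    have hp2 := hnorm p hp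
    have hexp : (A p - s.1) ^ 2 + (B p - s.2.1) ^ 2 + (C p - s.2.2) ^ 2 =
        (A p ^ 2 + B p ^ 2 + C p ^ 2) + ((s.1 : ℝ) ^ 2 + (s.2.1 : ℝ) ^ 2 + (s.2.2 : ℝ) ^ 2) -
          2 * (A p * (s.1 : ℝ) + B p * (s.2.1 : ℝ) + C p * (s.2.2 : ℝ)) := by ring
    linarith only [h0, hd1, hp2, hsn, hexp]
  -- foreignness: a point off the lattice has the slot triple of no slot
  have hforeign : ∀ p, p ∉ fccStacking 1 (Real.sqrt (2 / 3)) →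
      ∀ s ∈ ([((1 : ℤ), (1 : ℤ), (0 : ℤ)), (1, -1, 0), (-1, 1, 0), (-1, -1, 0), (1, 0, 1), (1, 0, -1),
        (-1, 0, 1), (-1, 0, -1), (0, 1, 1), (0, 1, -1), (0, -1, 1), (0, -1, -1)] : List (ℤ × ℤ × ℤ)), ¬ (A p = (s.1 : ℝ) ∧ B p = (s.2.1 : ℝ) ∧ C p = (s.2.2 : ℝ)) := by
    intro p hpΛ s hs hco
    obtain ⟨z, hzΛ, -, hz'⟩ := hsite s hs
    exact hpΛ ((hident s z p hz' hco) ▸ hzΛ)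
  -- the cubic-frame lemma
  obtain ⟨⟨f12, f13, f23⟩, t1, t2, t3⟩ := cubicShell_triple_vacancy (A y₁) (B y₁) (C y₁) (A y₂)
    (B y₂) (C y₂) (A y₃) (B y₃) (C y₃) (hnorm y₁ hy₁) (hnorm y₂ hy₂) (hnorm y₃ hy₃) v₁ v₂ v₃ hv₁
    hv₂ hv₃ hne12 hne13 hne23
    (hslots y₁ hy₁ fun z hz hqz e1 e2 e3 => (h z hz hqz e1 e2 e3).1)
    (hslots y₂ hy₂ fun z hz hqz e1 e2 e3 => (h z hz hqz e1 e2 e3).2.1)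
    (hslots y₃ hy₃ fun z hz hqz e1 e2 e3 => (h z hz hqz e1 e2 e3).2.2)
    (hforeign y₁ hy₁Λ) (hforeign y₂ hy₂Λ) (hforeign y₃ hy₃Λ)
    (hinner y₁ y₂ hy₁ hy₂ hy₁₂) (hinner y₁ y₃ hy₁ hy₃ hy₁₃) (hinner y₂ y₃ hy₂ hy₃ hy₂₃)
  -- the face: adjacent slots are sites at distance `1`
  have hface : ∀ (w w' : ℤ × ℤ × ℤ) (zw zw' : EuclideanSpace ℝ (Fin 3)), w ∈ ([((1 : ℤ), (1 : ℤ), (0 : ℤ)), (1, -1, 0), (-1, 1, 0), (-1, -1, 0), (1, 0, 1), (1, 0, -1),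
        (-1, 0, 1), (-1, 0, -1), (0, 1, 1), (0, 1, -1), (0, -1, 1), (0, -1, -1)] : List (ℤ × ℤ × ℤ)) → w' ∈ ([((1 : ℤ), (1 : ℤ), (0 : ℤ)), (1, -1, 0), (-1, 1, 0), (-1, -1, 0), (1, 0, 1), (1, 0, -1),
        (-1, 0, 1), (-1, 0, -1), (0, 1, 1), (0, 1, -1), (0, -1, 1), (0, -1, -1)] : List (ℤ × ℤ × ℤ)) →
      A zw = w.1 ∧ B zw = w.2.1 ∧ C zw = w.2.2 → A zw' = w'.1 ∧ B zw' = w'.2.1 ∧ C zw' = w'.2.2 →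
      w.1 * w'.1 + w.2.1 * w'.2.1 + w.2.2 * w'.2.2 = 1 → dist zw zw' = 1 := by
    rintro w w' zw zw' hw hw' ⟨h1, h2, h3⟩ ⟨h1', h2', h3'⟩ hd
    obtain ⟨-, n0⟩ := cubicShell_facts w hw
    obtain ⟨-, n0'⟩ := cubicShell_facts w' hw'
    have n : (w.1 : ℝ) ^ 2 + (w.2.1 : ℝ) ^ 2 + (w.2.2 : ℝ) ^ 2 = 2 := by exact_mod_cast n0
    have n' : (w'.1 : ℝ) ^ 2 + (w'.2.1 : ℝ) ^ 2 + (w'.2.2 : ℝ) ^ 2 = 2 := by exact_mod_cast n0'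
    have hdr : (w.1 : ℝ) * w'.1 + w.2.1 * w'.2.1 + w.2.2 * w'.2.2 = 1 := by exact_mod_cast hd
    have h0 := hcub zw zw'
    rw [h1, h2, h3, h1', h2', h3'] at h0
    have hsq1 : dist zw zw' ^ 2 = 1 := by linarith only [h0, n, n', hdr]
    exact (pow_eq_one_iff_of_nonneg dist_nonneg two_ne_zero).1 hsq1
  -- the twin positions: cubic coordinates are affine
  have hlin : ∀ zj : EuclideanSpace ℝ (Fin 3),
      A ((2 / 3 : ℝ) • (z₁ + z₂ + z₃) - zj) = 2 / 3 * (A z₁ + A z₂ + A z₃) - A zj ∧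
      B ((2 / 3 : ℝ) • (z₁ + z₂ + z₃) - zj) = 2 / 3 * (B z₁ + B z₂ + B z₃) - B zj ∧
      C ((2 / 3 : ℝ) • (z₁ + z₂ + z₃) - zj) = 2 / 3 * (C z₁ + C z₂ + C z₃) - C zj := by
    intro zj
    refine ⟨?_, ?_, ?_⟩
    · rw [hAp, hAp, hAp, hAp, hAp]
      simp only [PiLp.sub_apply, PiLp.add_apply, PiLp.smul_apply, smul_eq_mul]; ring
    · rw [hBp, hBp, hBp, hBp, hBp]
      simp only [PiLp.sub_apply, PiLp.add_apply, PiLp.smul_apply, smul_eq_mul]; ring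
    · rw [hCp, hCp, hCp, hCp, hCp]
      simp only [PiLp.sub_apply, PiLp.add_apply, PiLp.smul_apply, smul_eq_mul]; ring
  have htwin : ∀ p : EuclideanSpace ℝ (Fin 3),
      ((A p = 2 / 3 * ((v₁.1 : ℝ) + v₂.1 + v₃.1) - v₁.1 ∧
          B p = 2 / 3 * ((v₁.2.1 : ℝ) + v₂.2.1 + v₃.2.1) - v₁.2.1 ∧
          C p = 2 / 3 * ((v₁.2.2 : ℝ) + v₂.2.2 + v₃.2.2) - v₁.2.2) ∨
        (A p = 2 / 3 * ((v₁.1 : ℝ) + v₂.1 + v₃.1) - v₂.1 ∧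
          B p = 2 / 3 * ((v₁.2.1 : ℝ) + v₂.2.1 + v₃.2.1) - v₂.2.1 ∧
          C p = 2 / 3 * ((v₁.2.2 : ℝ) + v₂.2.2 + v₃.2.2) - v₂.2.2) ∨
        (A p = 2 / 3 * ((v₁.1 : ℝ) + v₂.1 + v₃.1) - v₃.1 ∧
          B p = 2 / 3 * ((v₁.2.1 : ℝ) + v₂.2.1 + v₃.2.1) - v₃.2.1 ∧
          C p = 2 / 3 * ((v₁.2.2 : ℝ) + v₂.2.2 + v₃.2.2) - v₃.2.2)) →
      (p = (2 / 3 : ℝ) • (z₁ + z₂ + z₃) - z₁ ∨ p = (2 / 3 : ℝ) • (z₁ + z₂ + z₃) - z₂ ∨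
        p = (2 / 3 : ℝ) • (z₁ + z₂ + z₃) - z₃) := by
    intro p hp
    rcases hp with ⟨e1, e2, e3⟩ | ⟨e1, e2, e3⟩ | ⟨e1, e2, e3⟩
    · left
      obtain ⟨l1, l2, l3⟩ := hlin z₁
      apply eq_of_cubic_sub_eq p ((2 / 3 : ℝ) • (z₁ + z₂ + z₃) - z₁) q
      · show A p = A ((2 / 3 : ℝ) • (z₁ + z₂ + z₃) - z₁)
        rw [l1, hv₁'.1, hv₂'.1, hv₃'.1]; exact e1
      · show B p = B ((2 / 3 : ℝ) • (z₁ + z₂ + z₃) - z₁)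
        rw [l2, hv₁'.2.1, hv₂'.2.1, hv₃'.2.1]; exact e2
      · show C p = C ((2 / 3 : ℝ) • (z₁ + z₂ + z₃) - z₁)
        rw [l3, hv₁'.2.2, hv₂'.2.2, hv₃'.2.2]; exact e3
    · right; left
      obtain ⟨l1, l2, l3⟩ := hlin z₂
      apply eq_of_cubic_sub_eq p ((2 / 3 : ℝ) • (z₁ + z₂ + z₃) - z₂) q
      · show A p = A ((2 / 3 : ℝ) • (z₁ + z₂ + z₃) - z₂)
        rw [l1, hv₁'.1, hv₂'.1, hv₃'.1]; exact e1
      · show B p = B ((2 / 3 : ℝ) • (z₁ + z₂ + z₃) - z₂)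
        rw [l2, hv₁'.2.1, hv₂'.2.1, hv₃'.2.1]; exact e2
      · show C p = C ((2 / 3 : ℝ) • (z₁ + z₂ + z₃) - z₂)
        rw [l3, hv₁'.2.2, hv₂'.2.2, hv₃'.2.2]; exact e3
    · right; right
      obtain ⟨l1, l2, l3⟩ := hlin z₃
      apply eq_of_cubic_sub_eq p ((2 / 3 : ℝ) • (z₁ + z₂ + z₃) - z₃) q
      · show A p = A ((2 / 3 : ℝ) • (z₁ + z₂ + z₃) - z₃)
        rw [l1, hv₁'.1, hv₂'.1, hv₃'.1]; exact e1
      · show B p = B ((2 / 3 : ℝ) • (z₁ + z₂ + z₃) - z₃)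
        rw [l2, hv₁'.2.1, hv₂'.2.1, hv₃'.2.1]; exact e2
      · show C p = C ((2 / 3 : ℝ) • (z₁ + z₂ + z₃) - z₃)
        rw [l3, hv₁'.2.2, hv₂'.2.2, hv₃'.2.2]; exact e3
  exact ⟨⟨hface v₁ v₂ z₁ z₂ hv₁ hv₂ hv₁' hv₂' f12, hface v₁ v₃ z₁ z₃ hv₁ hv₃ hv₁' hv₃' f13,
    hface v₂ v₃ z₂ z₃ hv₂ hv₃ hv₂' hv₃' f23⟩, htwin y₁ t1, htwin y₂ t2, htwin y₃ t3⟩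

/-- **Triple-vacancy lemma for a moved lattice `A·Λ₀ + t`.** -/
theorem fcc_triple_vacancy_moved
    (L : EuclideanSpace ℝ (Fin 3) ≃ₗᵢ[ℝ] EuclideanSpace ℝ (Fin 3)) (t : EuclideanSpace ℝ (Fin 3))
    (q y₁ y₂ y₃ z₁ z₂ z₃ : EuclideanSpace ℝ (Fin 3))
    (hq : q ∈ (fun p => L p + t) '' fccStacking 1 (Real.sqrt (2 / 3)))
    (hz₁ : z₁ ∈ (fun p => L p + t) '' fccStacking 1 (Real.sqrt (2 / 3)))
    (hz₂ : z₂ ∈ (fun p => L p + t) '' fccStacking 1 (Real.sqrt (2 / 3)))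
    (hz₃ : z₃ ∈ (fun p => L p + t) '' fccStacking 1 (Real.sqrt (2 / 3)))
    (hqz₁ : dist q z₁ = 1) (hqz₂ : dist q z₂ = 1) (hqz₃ : dist q z₃ = 1)
    (h12 : z₁ ≠ z₂) (h13 : z₁ ≠ z₃) (h23 : z₂ ≠ z₃)
    (hy₁ : dist q y₁ = 1) (hy₂ : dist q y₂ = 1) (hy₃ : dist q y₃ = 1)
    (hy₁Λ : y₁ ∉ (fun p => L p + t) '' fccStacking 1 (Real.sqrt (2 / 3)))
    (hy₂Λ : y₂ ∉ (fun p => L p + t) '' fccStacking 1 (Real.sqrt (2 / 3)))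
    (hy₃Λ : y₃ ∉ (fun p => L p + t) '' fccStacking 1 (Real.sqrt (2 / 3)))
    (hy₁₂ : 1 ≤ dist y₁ y₂) (hy₁₃ : 1 ≤ dist y₁ y₃) (hy₂₃ : 1 ≤ dist y₂ y₃)
    (h : ∀ z ∈ (fun p => L p + t) '' fccStacking 1 (Real.sqrt (2 / 3)), dist q z = 1 → z ≠ z₁ →
      z ≠ z₂ → z ≠ z₃ → 1 ≤ dist y₁ z ∧ 1 ≤ dist y₂ z ∧ 1 ≤ dist y₃ z) :
    (dist z₁ z₂ = 1 ∧ dist z₁ z₃ = 1 ∧ dist z₂ z₃ = 1) ∧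
    (y₁ = (2 / 3 : ℝ) • (z₁ + z₂ + z₃) - z₁ ∨ y₁ = (2 / 3 : ℝ) • (z₁ + z₂ + z₃) - z₂ ∨
      y₁ = (2 / 3 : ℝ) • (z₁ + z₂ + z₃) - z₃) ∧
    (y₂ = (2 / 3 : ℝ) • (z₁ + z₂ + z₃) - z₁ ∨ y₂ = (2 / 3 : ℝ) • (z₁ + z₂ + z₃) - z₂ ∨
      y₂ = (2 / 3 : ℝ) • (z₁ + z₂ + z₃) - z₃) ∧
    (y₃ = (2 / 3 : ℝ) • (z₁ + z₂ + z₃) - z₁ ∨ y₃ = (2 / 3 : ℝ) • (z₁ + z₂ + z₃) - z₂ ∨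
      y₃ = (2 / 3 : ℝ) • (z₁ + z₂ + z₃) - z₃) := by
  set f : EuclideanSpace ℝ (Fin 3) → EuclideanSpace ℝ (Fin 3) := fun s => L.symm (s - t) with hf
  have hfd : ∀ u w, dist (f u) (f w) = dist u w := by
    intro u w; simp only [hf]; rw [LinearIsometryEquiv.dist_map, dist_sub_right]
  have hfmem : ∀ u, u ∈ (fun p => L p + t) '' fccStacking 1 (Real.sqrt (2 / 3)) →
      f u ∈ fccStacking 1 (Real.sqrt (2 / 3)) := by
    rintro u ⟨p, hp, rfl⟩
    have : f (L p + t) = p := by simp [hf]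
    rw [this]; exact hp
  have hfnot : ∀ u, u ∉ (fun p => L p + t) '' fccStacking 1 (Real.sqrt (2 / 3)) →
      f u ∉ fccStacking 1 (Real.sqrt (2 / 3)) := by
    intro u hu hfu
    apply hu
    refine ⟨f u, hfu, ?_⟩
    simp [hf]
  have hfinv : ∀ p, f (L p + t) = p := fun p => by simp [hf]
  have hinj : Function.Injective f := by
    intro u w huw
    have : u - t = w - t := L.symm.injective huw
    simpa using this
  -- `f` is affine: it maps the twin positions to twin positions
  have hftwin : ∀ zj, f ((2 / 3 : ℝ) • (z₁ + z₂ + z₃) - zj) =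
      (2 / 3 : ℝ) • (f z₁ + f z₂ + f z₃) - f zj := by
    intro zj
    simp only [hf, map_sub, map_add, map_smul, smul_sub, smul_add]
    module
  have key := fcc_triple_vacancy (f q) (f y₁) (f y₂) (f y₃) (f z₁) (f z₂) (f z₃) (hfmem q hq)
    (hfmem z₁ hz₁) (hfmem z₂ hz₂) (hfmem z₃ hz₃) (by rw [hfd]; exact hqz₁) (by rw [hfd]; exact hqz₂)
    (by rw [hfd]; exact hqz₃) (fun e => h12 (hinj e)) (fun e => h13 (hinj e))
    (fun e => h23 (hinj e)) (by rw [hfd]; exact hy₁) (by rw [hfd]; exact hy₂)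
    (by rw [hfd]; exact hy₃) (hfnot y₁ hy₁Λ) (hfnot y₂ hy₂Λ) (hfnot y₃ hy₃Λ)
    (by rw [hfd]; exact hy₁₂) (by rw [hfd]; exact hy₁₃) (by rw [hfd]; exact hy₂₃) (by
      intro z hz hqz hzz₁ hzz₂ hzz₃
      have hz' : L z + t ∈ (fun p => L p + t) '' fccStacking 1 (Real.sqrt (2 / 3)) := ⟨z, hz, rfl⟩
      have h1 := h (L z + t) hz' (by rw [← hfd, hfinv]; exact hqz)
        (by intro hc; apply hzz₁; rw [← hfinv z, hc]) (by intro hc; apply hzz₂; rw [← hfinv z, hc])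
        (by intro hc; apply hzz₃; rw [← hfinv z, hc])
      rw [← hfd, ← hfd y₂, ← hfd y₃, hfinv] at h1
      exact h1)
  obtain ⟨⟨d12, d13, d23⟩, t1, t2, t3⟩ := key
  rw [hfd] at d12 d13 d23
  have conv : ∀ y, (f y = (2 / 3 : ℝ) • (f z₁ + f z₂ + f z₃) - f z₁ ∨
      f y = (2 / 3 : ℝ) • (f z₁ + f z₂ + f z₃) - f z₂ ∨
      f y = (2 / 3 : ℝ) • (f z₁ + f z₂ + f z₃) - f z₃) →
      (y = (2 / 3 : ℝ) • (z₁ + z₂ + z₃) - z₁ ∨ y = (2 / 3 : ℝ) • (z₁ + z₂ + z₃) - z₂ ∨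
        y = (2 / 3 : ℝ) • (z₁ + z₂ + z₃) - z₃) := by
    intro y hy
    rcases hy with e | e | e
    · left; exact hinj (by rw [hftwin]; exact e)
    · right; left; exact hinj (by rw [hftwin]; exact e)
    · right; right; exact hinj (by rw [hftwin]; exact e)
  exact ⟨⟨d12, d13, d23⟩, conv y₁ t1, conv y₂ t2, conv y₃ t3⟩

end Summit.Ventures.Crystal3D.Theorems

end
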